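import Literature.Computability.Complexity.SetLowerBoundProtocol
import Literature.Computability.Complexity.SamplingChernoff
import HarnessLib

/-!
# The Goldwasser–Sipser set lower-bound protocol, amplified with the Chernoff–Hoeffding bound

Trunk toolkit (theorems only), continuation of `SetLowerBoundProtocol.lean`, which proves the
per-test densities of the set lower-bound protocol over the affine hash family
(`AffineHash.hitDensity_ge_of_le_card`: `Pr[Hit] ≥ (3/4) K/2^k` if `|S| ≥ K`, `2K ≤ 2^k`;
`AffineHash.hitDensity_le_of_card_le`: `Pr[Hit] ≤ (1/2) K/2^k` if `2|S| ≤ K`) and amplifies them over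
`u` independent tests with threshold `(5/8) u K/2^k` by CHEBYSHEV (error `≤ 256/u`,
`lowerBound_completeness_count` / `lowerBound_soundness_count`). Here the SAME amplified protocol is
analysed with the Chernoff–Hoeffding counting bound of `SamplingChernoff.lean`
(`card_lowerDeviation_le_exp` / `card_upperDeviation_le_exp`), giving exponentially small errors
`≤ exp(-2u (K/2^k/8)²)` — the form stated by Goldwasser–Sipser and used wherever the protocol must
err with probability `2^{-t}` (e.g. Hirahara 2021, proof of Lemma 4.5: "`≥ 1 - 2^{-t}` … `< 2^{-t}`"):

* `AffineHash.lowerBound_completeness_exp` — `|S| ≥ K`, `2K ≤ 2^k`: the coin sequences with fewer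
  than `(5/8) u K/2^k` hits number `≤ exp(-2u(K/2^k/8)²) · |coins|^u`;
* `AffineHash.lowerBound_soundness_exp` — `2|S| ≤ K`: those with at least `(5/8) u K/2^k` hits
  number `≤ exp(-2u(K/2^k/8)²) · |coins|^u`;
* `AffineHash.lowerBound_half_*` — the case `K = 2^{k-1}` (`K/2^k = 1/2`): threshold `5u/16`, error
  `≤ exp(-u/128)`.

## References

* S. Goldwasser, M. Sipser, *Private coins versus public coins in interactive proof systems*,
  STOC 1986, §4.1 [GoldwasserSipser1986].
* S. Arora, B. Barak, *Computational Complexity: A Modern Approach*, CUP 2009, §8.2.2 (set lower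
  bound protocol; the amplified verifier with threshold `5p*/8`), Thm. 7.10 / §7.4.1 (Chernoff bound)
  [AroraBarakCC2009].
* W. Hoeffding, *Probability inequalities for sums of bounded random variables*, JASA 58 (1963), Thm. 1.
* S. Hirahara, ECCC TR21-058 (2021), proof of Lemma 4.5 (p. 27) [Hirahara2021].
-/

noncomputable section

namespace Literature.Computability.Complexity

open Finset Real

namespace AffineHash

variable {m k : ℕ}

open scoped Classical in
/-- **Completeness of the amplified lower-bound protocol, Chernoff form.** If `|S| ≥ K`
(`2K ≤ 2^k`), the coin sequences `ω` of `u ≥ 1` independent basic tests with fewer than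
`(5/8) u K/2^k` hits number at most `exp(-2u(K/2^k/8)²) · |coins|^u` (hits have density
`≥ (3/4) K/2^k`; lower deviation `≥ u K/2^k/8`). [cite: AroraBarakCC2009, §8.2.2 (Set lower bound protocol) with Thm. 7.10] -/
theorem lowerBound_completeness_exp {S : Finset (Fin m → ZMod 2)} {K : ℕ} (hKS : K ≤ S.card)
    (hK : 2 * K ≤ 2 ^ k) {u : ℕ} (hu : 0 < u) :
    ((univ.filter fun ω : Fin u → Hash m k × (Fin k → ZMod 2) =>
        ((univ.filter fun j => Hit S (ω j)).card : ℝ) < (5 / 8 : ℝ) * u * ((K : ℝ) / 2 ^ k)).card : ℝ) ≤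
      exp (-2 * u * ((K : ℝ) / 2 ^ k / 8) ^ 2) * Fintype.card (Fin u → Hash m k × (Fin k → ZMod 2)) := by
  set p : ℝ := ((univ.filter (Hit (k := k) S)).card : ℝ) /
    Fintype.card (Hash m k × (Fin k → ZMod 2)) with hp_def
  have hη : (0 : ℝ) ≤ (K : ℝ) / 2 ^ k / 8 := by positivity
  have hdev := card_lowerDeviation_le_exp (Hit (k := k) S) hu hη
  have hp : (3 / 4 : ℝ) * ((K : ℝ) / 2 ^ k) ≤ p := hitDensity_ge_of_le_card (k := k) hKS hK
  have hu' : (0 : ℝ) < u := by exact_mod_cast hu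
  have hsub : (univ.filter fun ω : Fin u → Hash m k × (Fin k → ZMod 2) =>
        ((univ.filter fun j => Hit S (ω j)).card : ℝ) < (5 / 8 : ℝ) * u * ((K : ℝ) / 2 ^ k)) ⊆
      (univ.filter fun ω : Fin u → Hash m k × (Fin k → ZMod 2) =>
        (u : ℝ) * ((K : ℝ) / 2 ^ k / 8) ≤
          u * (((univ.filter (Hit (k := k) S)).card : ℝ) / Fintype.card (Hash m k × (Fin k → ZMod 2))) -
            ((univ.filter fun i => Hit S (ω i)).card : ℝ)) := by
    intro ω hω
    rw [mem_filter] at hω ⊢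
    refine ⟨mem_univ _, ?_⟩
    rw [← hp_def]
    have hmul : (u : ℝ) * ((3 / 4 : ℝ) * ((K : ℝ) / 2 ^ k)) ≤ u * p := mul_le_mul_of_nonneg_left hp hu'.le
    linarith [hω.2]
  exact le_trans (by exact_mod_cast card_le_card hsub) hdev

open scoped Classical in
/-- **Soundness of the amplified lower-bound protocol, Chernoff form.** If `2|S| ≤ K` then the coin
sequences of `u ≥ 1` tests with at least `(5/8) u K/2^k` hits (whatever the prover answers, an
accepted test is a hit) number at most `exp(-2u(K/2^k/8)²) · |coins|^u` (density `≤ (1/2) K/2^k`;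
upper deviation `≥ u K/2^k/8`). [cite: AroraBarakCC2009, §8.2.2 (Set lower bound protocol) with Thm. 7.10] -/
theorem lowerBound_soundness_exp {S : Finset (Fin m → ZMod 2)} {K : ℕ} (hSK : 2 * S.card ≤ K)
    {u : ℕ} (hu : 0 < u) :
    ((univ.filter fun ω : Fin u → Hash m k × (Fin k → ZMod 2) =>
        (5 / 8 : ℝ) * u * ((K : ℝ) / 2 ^ k) ≤ ((univ.filter fun j => Hit S (ω j)).card : ℝ)).card : ℝ) ≤
      exp (-2 * u * ((K : ℝ) / 2 ^ k / 8) ^ 2) * Fintype.card (Fin u → Hash m k × (Fin k → ZMod 2)) := by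
  set p : ℝ := ((univ.filter (Hit (k := k) S)).card : ℝ) /
    Fintype.card (Hash m k × (Fin k → ZMod 2)) with hp_def
  have hη : (0 : ℝ) ≤ (K : ℝ) / 2 ^ k / 8 := by positivity
  have hdev := card_upperDeviation_le_exp (Hit (k := k) S) hu hη
  have hp : p ≤ (1 / 2 : ℝ) * ((K : ℝ) / 2 ^ k) := hitDensity_le_of_card_le (k := k) hSK
  have hu' : (0 : ℝ) < u := by exact_mod_cast hu
  have hsub : (univ.filter fun ω : Fin u → Hash m k × (Fin k → ZMod 2) =>
        (5 / 8 : ℝ) * u * ((K : ℝ) / 2 ^ k) ≤ ((univ.filter fun j => Hit S (ω j)).card : ℝ)) ⊆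
      (univ.filter fun ω : Fin u → Hash m k × (Fin k → ZMod 2) =>
        (u : ℝ) * ((K : ℝ) / 2 ^ k / 8) ≤
          ((univ.filter fun i => Hit S (ω i)).card : ℝ) -
            u * (((univ.filter (Hit (k := k) S)).card : ℝ) / Fintype.card (Hash m k × (Fin k → ZMod 2)))) := by
    intro ω hω
    rw [mem_filter] at hω ⊢
    refine ⟨mem_univ _, ?_⟩
    rw [← hp_def]
    have hmul : (u : ℝ) * p ≤ u * ((1 / 2 : ℝ) * ((K : ℝ) / 2 ^ k)) := mul_le_mul_of_nonneg_left hp hu'.le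
    linarith [hω.2]
  exact le_trans (by exact_mod_cast card_le_card hsub) hdev

/-! ### The case `K = 2^{k-1}`: density threshold `5/16`, error `exp(-u/128)` -/

/-- `exp(-2u (1/16)²) = exp(-u/128)`. [folklore] -/
theorem exp_half_case (u : ℕ) (k : ℕ) :
    exp (-2 * u * (((2 ^ k : ℕ) : ℝ) / 2 ^ (k + 1) / 8) ^ 2) = exp (-(u : ℝ) / 128) := by
  congr 1
  rw [Nat.cast_pow, Nat.cast_ofNat, pow_succ]
  field_simp
  ring

open scoped Classical in
/-- **Completeness, `K = 2^{k}` against `k+1` output bits** (`K/2^{k+1} = 1/2`): if `|S| ≥ 2^k` then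
the `u`-test sequences with fewer than `5u/16` hits number `≤ exp(-u/128) |coins|^u`.
[cite: AroraBarakCC2009, §8.2.2 (Set lower bound protocol)] -/
theorem lowerBound_half_completeness {S : Finset (Fin m → ZMod 2)} {k : ℕ} (hKS : 2 ^ k ≤ S.card)
    {u : ℕ} (hu : 0 < u) :
    ((univ.filter fun ω : Fin u → Hash m (k + 1) × (Fin (k + 1) → ZMod 2) =>
        ((univ.filter fun j => Hit S (ω j)).card : ℝ) < (5 / 16 : ℝ) * u).card : ℝ) ≤
      exp (-(u : ℝ) / 128) * Fintype.card (Fin u → Hash m (k + 1) × (Fin (k + 1) → ZMod 2)) := by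
  have h := lowerBound_completeness_exp (k := k + 1) (S := S) (K := 2 ^ k) hKS (by rw [pow_succ]; omega) hu
  have hratio : ((2 ^ k : ℕ) : ℝ) / 2 ^ (k + 1) = 1 / 2 := by
    rw [Nat.cast_pow, Nat.cast_ofNat, pow_succ]; field_simp
  rw [exp_half_case] at h
  rw [hratio] at h
  convert h using 4
  ring

open scoped Classical in
/-- **Soundness, `K = 2^{k}` against `k+1` output bits**: if `2|S| ≤ 2^k` then the `u`-test
sequences with at least `5u/16` hits number `≤ exp(-u/128) |coins|^u`.
[cite: AroraBarakCC2009, §8.2.2 (Set lower bound protocol)] -/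
theorem lowerBound_half_soundness {S : Finset (Fin m → ZMod 2)} {k : ℕ} (hSK : 2 * S.card ≤ 2 ^ k)
    {u : ℕ} (hu : 0 < u) :
    ((univ.filter fun ω : Fin u → Hash m (k + 1) × (Fin (k + 1) → ZMod 2) =>
        (5 / 16 : ℝ) * u ≤ ((univ.filter fun j => Hit S (ω j)).card : ℝ)).card : ℝ) ≤
      exp (-(u : ℝ) / 128) * Fintype.card (Fin u → Hash m (k + 1) × (Fin (k + 1) → ZMod 2)) := by
  have h := lowerBound_soundness_exp (k := k + 1) (S := S) (K := 2 ^ k) hSK hu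
  have hratio : ((2 ^ k : ℕ) : ℝ) / 2 ^ (k + 1) = 1 / 2 := by
    rw [Nat.cast_pow, Nat.cast_ofNat, pow_succ]; field_simp
  rw [exp_half_case] at h
  rw [hratio] at h
  convert h using 4
  ring

end AffineHash

end Literature.Computability.Complexity
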